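import Summits.BirchSwinnertonDyer.Rank1Residual.Additive.X4RankZeroKatoBoundManinFree
import Summits.BirchSwinnertonDyer.Rank1Residual.Additive.X4SharpThreeAssembly
import Summits.BirchSwinnertonDyer.Rank1Residual.Additive.X4ThreeResCertKernel
import HarnessLib

/-!
# X4♯(3) assembly on the certified rows WITHOUT the Manin datum: the V2M → V2A closure shapes (cell `b2b-bsdres`, team n1011 row T-b5; seat p08)

HONEST FRAMING (cell `b2b-bsdres`, run/shared/lean/b2b/bsd-rank1-residual/, verbatim in every
file): the goal of the cell is to DELETE the COMBINATION-SHAPED residual classes of the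
Birch–Swinnerton-Dyer formula for ALL analytic-rank `≤ 1` elliptic curves over `ℚ` — "full BSD
formula for every rank `≤ 1` curve in class `C`" assembled STRICTLY from published theorems — so
that the rank-`≤ 1` remainder becomes exactly the CONSTRUCTION-SHAPED classes, which are TYPED
(missing-input `Prop`s), NOT attempted. This is not "finishing BSD". Team n1011 (N10 / N11): prove
what is provable now; shrink each hard class to its core with data; no claim beyond stated classes;
research routes; census output = EVIDENCE / conjecture items, never a Literature fact; RESIDUAL-MAP
marks change only by signed lines; nothing is booked by this file.

Theorems only (no definition, no new named fact). Companion of `X4SharpThreeAssembly.lean`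
(additive-p4 GEN 13, p244427: `X4RankZero.bsdp_three_of_cert_of_shaAn_unit` — the census shape that
closes `BSD(E,3)` per pair on X4 ∧ `r_an = 0` ∧ surj(3) ∧ [`ord₃ j < 0` ∨ `j`-witness ∨ surj(9)] ∧
`3 ∤ ∏ c_ℓ` ∧ `3 ∤ #Ш_an`, carrying on its potentially-good branch the Kato fact A154 AND a
modular-parametrisation datum `D` with `3 ∤ c_D`). Here the potentially-good branch runs through the
MANIN-FREE sharpened reading A161′
(`Kato2004.rankZero_padicValNat_sha_le_sub_localTamagawa_of_additive_potGood_of_imageContainsSL2_maninFree`,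
p252712; consumers `X4RankZeroKatoBoundManinFree.lean`) and the (M) branch is unchanged
(additive-p1's `ClassX4M.bsdp_three_rankZero_of_surj_of_shaAn_unit`, which uses only the EXISTENCE of
a parametrisation, `nonempty_modularParametrizationData`, never its Manin constant):
* `X4RankZero.bsdp_three_of_katoManinFree_of_surj_of_jWitness`,
  `X4RankZero.missingUpperBoundAt_three_of_katoManinFree_of_surj_of_jWitness` — the V21 pair without `D`;
* **`X4RankZero.bsdp_three_of_cert_of_shaAn_unit_maninFree`** — the census shape with NO `D`/`3 ∤ c_D`
  binder: on the census this is the theorem under which the 1 751 V2M = MANIN-DB@3 cells of the V20X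
  transport read exactly like the V2A cells (referee A R196.7: "flags stay until a row without a
  Manin binder closes the cell" — this is that row shape; BOOKING is the lane's / director's, not this
  file's; the reading flag `Kato-14.5(3)-14.16(2)-additive-potgood-reading-sharp` travels with it);
* `X4RankZero.missingUpperBoundAt_three_of_cert_maninFree`, `X4RankZero.bsdp_three_of_cert_of_lower_maninFree`
  — the typed UPPER half and "what remains is EXACTLY the lower half" on the certified rows, datum-free.
The Tamagawa hypothesis stays `3 ∤ ∏ c_ℓ` as in the census shape (it gives
`ord₃ ∏ c_ℓ = 0 = v₃(c₃)` through `Additive.localTamagawaNumber_padic_dvd_tamagawaProduct`).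
Per pair; X4's label is UNCHANGED (CONSTRUCTION-SHAPED); nothing is booked by this file.

References: Kato 2004 [Kato2004Asterisque] Thm. 14.5 (3) (p. 236), Prop. 14.16 (2) (p. 244), Thm.
17.4 (3); Delbourgo 1998 [Delbourgo1998] Prop. 4; Wuthrich 2014 [Wuthrich2014] Lemma 20, Cor. 19;
Miller 2011 [Miller2011LMS] Def. 1.1; Serre 1968 IV §3.4; Silverman *ATAEC* V.5.3.
-/

noncomputable section

open scoped Classical

open WeierstrassCurve Literature.NumberTheory.EllipticCurves
  Literature.NumberTheory.EllipticCurves.ModularForms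
  Literature.NumberTheory.EllipticCurves.Rank1Residual
  Literature.NumberTheory.EllipticCurves.Rank1Residual.Typed

namespace Summit.BirchSwinnertonDyer.Rank1Residual.Additive

variable (W : WeierstrassCurve ℚ) [W.IsElliptic] [W.IsGloballyMinimal]

omit [W.IsGloballyMinimal] in
/-- `p ∤ ∏_ℓ c_ℓ` ⟹ `ord_p ∏_ℓ c_ℓ = v_p(c_p)` (both vanish: `c_p ∣ ∏ c_ℓ`,
`Additive.localTamagawaNumber_padic_dvd_tamagawaProduct`). Bookkeeping. [folklore] -/
theorem padicValNat_tamagawaProduct_eq_localTamagawa_of_not_dvd (p : ℕ) [Fact p.Prime]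
    (htam : ¬ p ∣ W.tamagawaProduct) :
    padicValNat p W.tamagawaProduct = padicValNat p ((W.baseChange ℚ_[p]).localTamagawaNumber ℤ_[p]) := by
  have h1 : padicValNat p W.tamagawaProduct = 0 := padicValNat.eq_zero_of_not_dvd htam
  have h2 : ¬ p ∣ (W.baseChange ℚ_[p]).localTamagawaNumber ℤ_[p] := fun h ↦
    htam (dvd_trans h (Additive.localTamagawaNumber_padic_dvd_tamagawaProduct W p))
  rw [h1, padicValNat.eq_zero_of_not_dvd h2]

/-- **V21 without the datum**: `BSD(E,3)` on X4 ∧ `r_an = 0` ∧ `ord₃ j ≥ 0` ∧ surj(3) ∧ `j`-witness ∧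
`3 ∤ ∏ c_ℓ` ∧ `#Ш_an` a `3`-unit, from the Manin-free reading A161′ (twin of
`X4RankZero.bsdp_three_of_kato_of_surj_of_jWitness`).
[cite: Kato2004Asterisque, Thm. 14.5 (3) (p. 236), (12.5.2) (p. 222)] [cite: Miller2011LMS, §1 and Def. 1.1] -/
theorem X4RankZero.bsdp_three_of_katoManinFree_of_surj_of_jWitness
    (hKato : Kato2004.rankZero_padicValNat_sha_le_sub_localTamagawa_of_additive_potGood_of_imageContainsSL2_maninFree)
    (hGZK : rank_eq_analyticRank_of_analyticRank_le_one) (hmod : hasEntireLFunction_rat)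
    (hr : W.analyticRank = 0) (hX : ClassX4 W 3) (hpot : 0 ≤ padicValRat 3 W.j) (hsurj : Surj W 3)
    (hJ : ∃ q : ℕ, q.Prime ∧ q ≠ 3 ∧ padicValRat q W.j < 0 ∧ ¬ (3 : ℤ) ∣ padicValRat q W.j)
    (htam : ¬ 3 ∣ W.tamagawaProduct)
    {q : ℚ} (hq : shaAn W = (q : ℂ)) (hv : padicValRat 3 q = 0) : BSDp W 3 :=
  haveI : Fact (Nat.Prime 3) := ⟨Nat.prime_three⟩
  X4RankZero.bsdp_of_shaAn_unit_of_katoManinFree W 3 hKato hGZK hmod hr hX hpot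
    (towerSurj_three_of_surj_of_jWitness W hsurj hJ)
    (padicValNat_tamagawaProduct_eq_localTamagawa_of_not_dvd W 3 htam) hq hv

/-- **The typed upper half at `p = 3` with a `j`-witness, datum-free** (twin of
`X4RankZero.missingUpperBoundAt_three_of_kato_of_surj_of_jWitness`).
[cite: Kato2004Asterisque, Thm. 14.5 (3) (p. 236)] [cite: Miller2011LMS, Def. 1.1] -/
theorem X4RankZero.missingUpperBoundAt_three_of_katoManinFree_of_surj_of_jWitness
    (hKato : Kato2004.rankZero_padicValNat_sha_le_sub_localTamagawa_of_additive_potGood_of_imageContainsSL2_maninFree)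
    (hGZK : rank_eq_analyticRank_of_analyticRank_le_one) (hmod : hasEntireLFunction_rat)
    (hr : W.analyticRank = 0) (hX : ClassX4 W 3) (hpot : 0 ≤ padicValRat 3 W.j) (hsurj : Surj W 3)
    (hJ : ∃ q : ℕ, q.Prime ∧ q ≠ 3 ∧ padicValRat q W.j < 0 ∧ ¬ (3 : ℤ) ∣ padicValRat q W.j)
    (htam : ¬ 3 ∣ W.tamagawaProduct) : MissingUpperBoundAt W 3 :=
  haveI : Fact (Nat.Prime 3) := ⟨Nat.prime_three⟩
  X4RankZero.missingUpperBoundAt_of_katoManinFree W 3 hKato hGZK hmod hr hX hpot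
    (towerSurj_three_of_surj_of_jWitness W hsurj hJ)
    (padicValNat_tamagawaProduct_eq_localTamagawa_of_not_dvd W 3 htam)

/-- **`BSD(E,3)` on every X4♯(3) unit row with a certificate — NO Manin datum**: X4 ∧ `r_an = 0` ∧
surj(3) ∧ `3 ∤ ∏ c_ℓ` ∧ `#Ш_an` a `3`-unit ∧ [`ord₃ j < 0` ∨ `j`-witness ∨ surj(9)]. The (M) branch is
additive-p1's `ClassX4M.bsdp_three_rankZero_of_surj_of_shaAn_unit` (existence of a parametrisation
only, `hmodD`); the potentially good branch is the Manin-free Kato reading A161′. Twin of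
`X4RankZero.bsdp_three_of_cert_of_shaAn_unit` with the binders `D`, `3 ∤ c_D` DELETED — the census
shape under which the V2M (MANIN-DB@3) cells read like V2A cells (booking not this file's).
[cite: Kato2004Asterisque, Thm. 14.5 (3) (p. 236), Thm. 17.4 (3) (p. 273)] [cite: Delbourgo1998, Prop. 4 (p. 144)]
[cite: Miller2011LMS, §1 and Def. 1.1] -/
theorem X4RankZero.bsdp_three_of_cert_of_shaAn_unit_maninFree
    (hKato : Kato2004.rankZero_padicValNat_sha_le_sub_localTamagawa_of_additive_potGood_of_imageContainsSL2_maninFree)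
    (hDel : Delbourgo1998.prop4_rankZero_pow_dvd_constantCoeff)
    (hGZK : rank_eq_analyticRank_of_analyticRank_le_one) (hmod : hasEntireLFunction_rat)
    (hmodD : nonempty_modularParametrizationData)
    (hL20 : Wuthrich2014.lemma20_surjective_threeAdic_of_semistable)
    (hKatoω : Wuthrich2014.kato_minusEigenCharIdeal_dvd_cyclotomicThree_of_surjective)
    (hr : W.analyticRank = 0) (hX : ClassX4 W 3) (hsurj : Surj W 3)
    (hcert : padicValRat 3 W.j < 0 ∨
      (∃ q : ℕ, q.Prime ∧ q ≠ 3 ∧ padicValRat q W.j < 0 ∧ ¬ (3 : ℤ) ∣ padicValRat q W.j) ∨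
        W.HasSurjectiveModNGaloisRep 9)
    (htam : ¬ 3 ∣ W.tamagawaProduct)
    {q : ℚ} (hq : shaAn W = (q : ℂ)) (hv : padicValRat 3 q = 0) : BSDp W 3 := by
  haveI : Fact (Nat.Prime 3) := ⟨Nat.prime_three⟩
  by_cases hj : padicValRat 3 W.j < 0
  · exact AdditivePotMult.ClassX4M.bsdp_three_rankZero_of_surj_of_shaAn_unit hDel hGZK hmod hmodD
      hL20 hKatoω ⟨hX, hX.2.1, hj⟩ hr hsurj hq hv
  · have hc' : (∃ q : ℕ, q.Prime ∧ q ≠ 3 ∧ padicValRat q W.j < 0 ∧ ¬ (3 : ℤ) ∣ padicValRat q W.j) ∨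
        W.HasSurjectiveModNGaloisRep 9 := by
      rcases hcert with h | h | h
      · exact absurd h hj
      · exact Or.inl h
      · exact Or.inr h
    exact X4RankZero.bsdp_of_shaAn_unit_of_katoManinFree W 3 hKato hGZK hmod hr hX (not_lt.mp hj)
      (towerSurj_three_of_surj_of_jWitness_or_nine W hsurj hc')
      (padicValNat_tamagawaProduct_eq_localTamagawa_of_not_dvd W 3 htam) hq hv

/-- **The typed UPPER HALF on every certified row — NO Manin datum** (twin of
`X4RankZero.missingUpperBoundAt_three_of_cert`).
[cite: Kato2004Asterisque, Thm. 14.5 (3) (p. 236), Thm. 17.4 (3) (p. 273)] [cite: Delbourgo1998, Prop. 4 (p. 144)]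
[cite: Miller2011LMS, Def. 1.1] -/
theorem X4RankZero.missingUpperBoundAt_three_of_cert_maninFree
    (hKato : Kato2004.rankZero_padicValNat_sha_le_sub_localTamagawa_of_additive_potGood_of_imageContainsSL2_maninFree)
    (hDel : Delbourgo1998.prop4_rankZero_pow_dvd_constantCoeff)
    (hGZK : rank_eq_analyticRank_of_analyticRank_le_one) (hmod : hasEntireLFunction_rat)
    (hmodD : nonempty_modularParametrizationData)
    (hL20 : Wuthrich2014.lemma20_surjective_threeAdic_of_semistable)
    (hKatoω : Wuthrich2014.kato_minusEigenCharIdeal_dvd_cyclotomicThree_of_surjective)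
    (hr : W.analyticRank = 0) (hX : ClassX4 W 3) (hsurj : Surj W 3)
    (hcert : padicValRat 3 W.j < 0 ∨
      (∃ q : ℕ, q.Prime ∧ q ≠ 3 ∧ padicValRat q W.j < 0 ∧ ¬ (3 : ℤ) ∣ padicValRat q W.j) ∨
        W.HasSurjectiveModNGaloisRep 9)
    (htam : ¬ 3 ∣ W.tamagawaProduct) : MissingUpperBoundAt W 3 := by
  haveI : Fact (Nat.Prime 3) := ⟨Nat.prime_three⟩
  by_cases hj : padicValRat 3 W.j < 0
  · exact AdditivePotMult.ClassX4M.missingUpperBoundAt_three_rankZero_of_surj hDel hGZK hmod hmodD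
      hL20 hKatoω ⟨hX, hX.2.1, hj⟩ hr hsurj
  · have hc' : (∃ q : ℕ, q.Prime ∧ q ≠ 3 ∧ padicValRat q W.j < 0 ∧ ¬ (3 : ℤ) ∣ padicValRat q W.j) ∨
        W.HasSurjectiveModNGaloisRep 9 := by
      rcases hcert with h | h | h
      · exact absurd h hj
      · exact Or.inl h
      · exact Or.inr h
    exact X4RankZero.missingUpperBoundAt_of_katoManinFree W 3 hKato hGZK hmod hr hX (not_lt.mp hj)
      (towerSurj_three_of_surj_of_jWitness_or_nine W hsurj hc')
      (padicValNat_tamagawaProduct_eq_localTamagawa_of_not_dvd W 3 htam)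

/-- **The `3 ∣ #Ш_an` certified rows, datum-free: `BSD(E,3)` from the LOWER half alone** (twin of
`X4RankZero.bsdp_three_of_cert_of_lower`): what remains there is EXACTLY `MissingLowerBoundAt W 3`.
[cite: Kato2004Asterisque, Thm. 14.5 (3) (p. 236), Thm. 17.4 (3) (p. 273)] [cite: Delbourgo1998, Prop. 4 (p. 144)]
[cite: Miller2011LMS, §1 and Def. 1.1] -/
theorem X4RankZero.bsdp_three_of_cert_of_lower_maninFree
    (hKato : Kato2004.rankZero_padicValNat_sha_le_sub_localTamagawa_of_additive_potGood_of_imageContainsSL2_maninFree)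
    (hDel : Delbourgo1998.prop4_rankZero_pow_dvd_constantCoeff)
    (hGZK : rank_eq_analyticRank_of_analyticRank_le_one) (hmod : hasEntireLFunction_rat)
    (hmodD : nonempty_modularParametrizationData)
    (hL20 : Wuthrich2014.lemma20_surjective_threeAdic_of_semistable)
    (hKatoω : Wuthrich2014.kato_minusEigenCharIdeal_dvd_cyclotomicThree_of_surjective)
    (hr : W.analyticRank = 0) (hX : ClassX4 W 3) (hsurj : Surj W 3)
    (hcert : padicValRat 3 W.j < 0 ∨
      (∃ q : ℕ, q.Prime ∧ q ≠ 3 ∧ padicValRat q W.j < 0 ∧ ¬ (3 : ℤ) ∣ padicValRat q W.j) ∨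
        W.HasSurjectiveModNGaloisRep 9)
    (htam : ¬ 3 ∣ W.tamagawaProduct) (hlow : MissingLowerBoundAt W 3) : BSDp W 3 := by
  haveI : Fact (Nat.Prime 3) := ⟨Nat.prime_three⟩
  exact bsdp_of_missingPPartAt W 3 hGZK (by rw [hr]; exact zero_le_one)
    (missingPPartAt_of_lower_of_upper W 3 hlow
      (X4RankZero.missingUpperBoundAt_three_of_cert_maninFree W hKato hDel hGZK hmod hmodD hL20 hKatoω
        hr hX hsurj hcert htam))

end Summit.BirchSwinnertonDyer.Rank1Residual.Additive

end
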